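import Summits.BirchSwinnertonDyer.Rank1Residual.Partition.MainConjecturesCMAnyOrder
import Literature.NumberTheory.EllipticCurves.ComplexMultiplicationShaKnappProofs
import Literature.NumberTheory.EllipticCurves.MordellCurveThreeDescent
import HarnessLib

/-!
# Route `PrintCf2`, inert type: the two NON-MAXIMAL `ℚ(√−3)`-classes have explicit MORDELL PARTNERS —
# `j = 54000` ∼ `y² = x³ + d³` (`36a1^{(d)}`), `j = −12288000` ∼ `y² = x³ + 16d³` (`27a3^{(d)}`),
# `d` squarefree (cell `bsd-print-cf2`, seat p4; serves item 20363 `InertTwoRankOneOfFacts`)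

HONEST FRAMING (cell `bsd-print-cf2`, D-0131 (2) print tier, PARTITION currency): nothing is closed
here; ROUTE-INDEPENDENT file (no `Theses` import). `PrintCf2MaximalOrderReduction` (p540203)
proved abstractly that the `ℚ(√−3)` part of the inert crux (`stub_inert_eisensteinField`,
`j ∈ {0, 54000, −12288000}`) reads on `j = 0`. This file makes the two isogeny steps EXPLICIT in the
currency of the printed families (Mordell curves `y² = x³ + k`, quadratic twists of a fixed curve):

* §1 `j = 54000` (order of discriminant `−12`, `36a2`-shape `E₁₂ = [0,6,0,−3,0]` — cell p3's
  `curve36a1'`): `exists_isIsogenous_mordell_of_j_eq_54000` — `W ∼_ℚ y² = x³ + d³` for a squarefree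
  `d ≠ 0`, i.e. the QUADRATIC TWIST BY `d` OF `36a1 : y² = x³ + 1` (the tree's `2`-isogeny
  `E₁₂ ~ E₁₂' = [0,−12,0,48,0]` twisted; `E₁₂'^{(d)} = (x − 4d)³ + 64d³` under `(u, r) = (2, 4d)`).
* §2 `j = −12288000` (discriminant `−27`, `27a2/27a4`-shape `E₂₇ = [0,36,0,−48,16]`; `27a1`, `27a3` have `j = 0`):
  `exists_isIsogenous_mordell_of_j_eq_neg12288000` — `W ∼_ℚ y² = x³ + 16d³` for a squarefree
  `d ≠ 0`, i.e. the quadratic twist by `d` of `27a3 : y² = x³ + 16 (≅ y² + y = x³)` (Vélu's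
  `3`-isogeny `E₂₇ ~ [0,36,0,432,13392]` twisted; `= (x + 12d)³ + 11664d³` under `(u, r) = (3, −12d)`).
* §3 `bsdp_two_iff_mordellPartner` — granted Cassels/GZK/modularity, `BSD(W,2) ⟺ BSD(W′,2)` for a
  globally minimal model `W′` of the partner, in analytic rank `≤ 1`; hence
  `inert_j54000_iff_twist36`, `inert_jNeg12288000_iff_twist27`: the two non-maximal inert classes of
  analytic rank one ⟺ «`BSD(·,2)` on the rank-one global minimal models of `y² = x³ + d³`» resp.
  «… of `y² = x³ + 16d³`», `d` squarefree — the Shu–Zhai 2021 (36a1) / Kriz–Li 2019 Thm 1.12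
  (E(ℚ)[2] = 0, e.g. 27a) twist currencies of cell p3's road.

beyond-print theorem: NO (Cassels' isogeny invariance; Cremona classes `36a`, `27a`). References:
[cite: SilvermanAEC2009, X.5 Prop. 5.4 and Cor. 5.4.1]; [cite: SilvermanAEC2009, III.4 Example 4.5];
[cite: CremonaAlgorithms1997, §3.8 and Table 1 (classes 27a, 36a)]; [cite: MilneADT2006, Thm. I.7.3];
[cite: Miller2011LMS, §1 and Def. 1.1]; [cite: SilvermanATAEC1994, App. A §3].
-/

set_option linter.dupNamespace false -- namespace `…BirchSwinnertonDyer.BirchSwinnertonDyer…` (D-0017 nested layout)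
set_option autoImplicit false

noncomputable section

open scoped Classical

open WeierstrassCurve Literature.NumberTheory.EllipticCurves
  Literature.NumberTheory.EllipticCurves.Rank1Residual
open Summit.BirchSwinnertonDyer.Rank1Residual

namespace Summit.BirchSwinnertonDyer.BirchSwinnertonDyer.Theorems.PrintCf2

/-! ## §1 `j = 54000`: the partner `y² = x³ + d³ = 36a1^{(d)}` -/

/-- The quadratic twist of `E₁₂' = [0,−12,0,48,0]` by `d` is `[0, −12d, 0, 48d², 0]`. [folklore] -/
theorem quadraticTwist_cm12' (d : ℚ) :
    (⟨0, -12, 0, 48, 0⟩ : WeierstrassCurve ℚ).quadraticTwist d =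
      ⟨0, -12 * d, 0, 48 * d ^ 2, 0⟩ := by
  ext <;> simp [quadraticTwist, b₂, b₄, b₆] <;> ring

/-- `(u, r) = (2, 4d)` carries `y² = x³ − 12d x² + 48d² x = (x − 4d)³ + 64d³` to the Mordell curve
`y² = x³ + d³`. [cite: CremonaAlgorithms1997, §3.8 and Table 1 (classes 27a, 36a)] -/
theorem smul_twist_cm12'_eq_mordellCurve (d : ℚ) :
    (⟨Units.mk0 (2 : ℚ) two_ne_zero, 4 * d, 0, 0⟩ : VariableChange ℚ) •
        (⟨0, -12 * d, 0, 48 * d ^ 2, 0⟩ : WeierstrassCurve ℚ) = mordellCurve (d ^ 3) := by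
  ext
  · simp [mordellCurve, variableChange_a₁]
  · simp only [mordellCurve, variableChange_a₂, Units.val_inv_eq_inv_val, Units.val_mk0]
    ring
  · simp [mordellCurve, variableChange_a₃]
  · simp only [mordellCurve, variableChange_a₄, Units.val_inv_eq_inv_val, Units.val_mk0]
    ring
  · simp only [mordellCurve, variableChange_a₆, Units.val_inv_eq_inv_val, Units.val_mk0]
    ring

/-- **Every `j = 54000` curve over `ℚ` is `ℚ`-isogenous to `y² = x³ + d³` (the twist of `36a1` by
`d`) for a squarefree `d ≠ 0`.** [cite: SilvermanAEC2009, X.5 Prop. 5.4 and Cor. 5.4.1]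
[cite: SilvermanAEC2009, III.4 Example 4.5] [cite: CremonaAlgorithms1997, §3.8 and Table 1 (classes 27a, 36a)] -/
theorem exists_isIsogenous_mordell_of_j_eq_54000 (W : WeierstrassCurve ℚ) [W.IsElliptic]
    (hj : W.j = 54000) :
    ∃ d : ℤ, d ≠ 0 ∧ Squarefree d ∧ IsIsogenous W (mordellCurve ((d : ℚ) ^ 3)) := by
  obtain ⟨d, hd0, hsq, C, hC⟩ := exists_variableChange_eq_quadraticTwist_intCast_of_j_eq
    (W := W) (E := (⟨0, 6, 0, -3, 0⟩ : WeierstrassCurve ℚ)) (by rw [hj, j_cm12])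
    (by rw [j_cm12]; norm_num) (by rw [j_cm12]; norm_num)
  have hdQ : (d : ℚ) ≠ 0 := by exact_mod_cast hd0
  haveI := isElliptic_mordellCurve (pow_ne_zero 3 hdQ)
  haveI := (⟨0, 6, 0, -3, 0⟩ : WeierstrassCurve ℚ).isElliptic_quadraticTwist hdQ
  haveI := (⟨0, -12, 0, 48, 0⟩ : WeierstrassCurve ℚ).isElliptic_quadraticTwist hdQ
  refine ⟨d, hd0, hsq, ?_⟩
  have h1 : IsIsogenous W ((⟨0, 6, 0, -3, 0⟩ : WeierstrassCurve ℚ).quadraticTwist (d : ℚ)) :=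
    isIsogenous_of_smul_eq hC
  have h2 : IsIsogenous ((⟨0, 6, 0, -3, 0⟩ : WeierstrassCurve ℚ).quadraticTwist (d : ℚ))
      ((⟨0, -12, 0, 48, 0⟩ : WeierstrassCurve ℚ).quadraticTwist (d : ℚ)) :=
    isIsogenous_cm12.quadraticTwist hdQ
  have h3 : IsIsogenous ((⟨0, -12, 0, 48, 0⟩ : WeierstrassCurve ℚ).quadraticTwist (d : ℚ))
      (mordellCurve ((d : ℚ) ^ 3)) := by
    rw [quadraticTwist_cm12']
    exact isIsogenous_of_smul_eq (smul_twist_cm12'_eq_mordellCurve (d : ℚ))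
  exact h1.trans' (h2.trans' h3)

/-- Conversely `y² = x³ + d³` (`d ≠ 0`) is the partner of a GLOBALLY MINIMAL `j = 54000` curve.
[cite: SilvermanAEC2009, VIII.8, Cor. 8.3] [cite: CremonaAlgorithms1997, §3.8 and Table 1 (classes 27a, 36a)] -/
theorem exists_j54000_isIsogenous_mordell {d : ℚ} (hd : d ≠ 0) :
    ∃ (W : WeierstrassCurve ℚ) (_ : W.IsElliptic) (_ : W.IsGloballyMinimal),
      W.j = 54000 ∧ IsIsogenous W (mordellCurve (d ^ 3)) := by
  haveI := isElliptic_mordellCurve (pow_ne_zero 3 hd)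
  haveI := (⟨0, 6, 0, -3, 0⟩ : WeierstrassCurve ℚ).isElliptic_quadraticTwist hd
  haveI := (⟨0, -12, 0, 48, 0⟩ : WeierstrassCurve ℚ).isElliptic_quadraticTwist hd
  obtain ⟨C, hC⟩ := hasGlobalMinimalModel_rat_holds
    ((⟨0, 6, 0, -3, 0⟩ : WeierstrassCurve ℚ).quadraticTwist d)
  refine ⟨C • (⟨0, 6, 0, -3, 0⟩ : WeierstrassCurve ℚ).quadraticTwist d, inferInstance, hC, ?_, ?_⟩
  · rw [variableChange_j, j_quadraticTwist _ hd, j_cm12]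
  · have h2 : IsIsogenous ((⟨0, 6, 0, -3, 0⟩ : WeierstrassCurve ℚ).quadraticTwist d)
        ((⟨0, -12, 0, 48, 0⟩ : WeierstrassCurve ℚ).quadraticTwist d) :=
      isIsogenous_cm12.quadraticTwist hd
    have h3 : IsIsogenous ((⟨0, -12, 0, 48, 0⟩ : WeierstrassCurve ℚ).quadraticTwist d)
        (mordellCurve (d ^ 3)) := by
      rw [quadraticTwist_cm12']
      exact isIsogenous_of_smul_eq (smul_twist_cm12'_eq_mordellCurve d)
    exact (isIsogenous_of_smul _ C).trans' (h2.trans' h3)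

/-! ## §2 `j = −12288000`: the partner `y² = x³ + 16d³ = 27a3^{(d)}` -/

/-- The quadratic twist of `E₂₇' = [0,36,0,432,13392]` by `d` is `[0, 36d, 0, 432d², 13392d³]`.
[folklore] -/
theorem quadraticTwist_cm27' (d : ℚ) :
    (⟨0, 36, 0, 432, 13392⟩ : WeierstrassCurve ℚ).quadraticTwist d =
      ⟨0, 36 * d, 0, 432 * d ^ 2, 13392 * d ^ 3⟩ := by
  ext <;> simp [quadraticTwist, b₂, b₄, b₆] <;> ring

/-- `(u, r) = (3, −12d)` carries `y² = x³ + 36d x² + 432d² x + 13392d³ = (x + 12d)³ + 11664d³` to the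
Mordell curve `y² = x³ + 16d³`. [cite: CremonaAlgorithms1997, §3.8 and Table 1 (classes 27a, 36a)] -/
theorem smul_twist_cm27'_eq_mordellCurve (d : ℚ) :
    (⟨Units.mk0 (3 : ℚ) three_ne_zero, -12 * d, 0, 0⟩ : VariableChange ℚ) •
        (⟨0, 36 * d, 0, 432 * d ^ 2, 13392 * d ^ 3⟩ : WeierstrassCurve ℚ) =
      mordellCurve (16 * d ^ 3) := by
  ext
  · simp [mordellCurve, variableChange_a₁]
  · simp only [mordellCurve, variableChange_a₂, Units.val_inv_eq_inv_val, Units.val_mk0]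
    ring
  · simp [mordellCurve, variableChange_a₃]
  · simp only [mordellCurve, variableChange_a₄, Units.val_inv_eq_inv_val, Units.val_mk0]
    ring
  · simp only [mordellCurve, variableChange_a₆, Units.val_inv_eq_inv_val, Units.val_mk0]
    ring

/-- **Every `j = −12288000` curve over `ℚ` is `ℚ`-isogenous to `y² = x³ + 16d³` (the twist of
`27a3 : y² = x³ + 16` by `d`) for a squarefree `d ≠ 0`**, by Vélu's `3`-isogeny of the tree
(`isIsogenous_cm27`) twisted along `j`. [cite: SilvermanAEC2009, X.5 Prop. 5.4 and Cor. 5.4.1]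
[cite: CremonaAlgorithms1997, §3.8 and Table 1 (classes 27a, 36a)] -/
theorem exists_isIsogenous_mordell_of_j_eq_neg12288000 (W : WeierstrassCurve ℚ) [W.IsElliptic]
    (hj : W.j = -12288000) :
    ∃ d : ℤ, d ≠ 0 ∧ Squarefree d ∧ IsIsogenous W (mordellCurve (16 * (d : ℚ) ^ 3)) := by
  haveI hE' := isElliptic_threeIsogenyCodomain (m := (6 : ℚ)) (s := -4)
  obtain ⟨d, hd0, hsq, C, hC⟩ := exists_variableChange_eq_quadraticTwist_intCast_of_j_eq
    (W := W) (E := threeTorsionModel (6 : ℚ) (-4)) (by rw [hj, j_threeTorsionModel_cm27])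
    (by rw [j_threeTorsionModel_cm27]; norm_num) (by rw [j_threeTorsionModel_cm27]; norm_num)
  have hdQ : (d : ℚ) ≠ 0 := by exact_mod_cast hd0
  have h16 : (16 : ℚ) * (d : ℚ) ^ 3 ≠ 0 := mul_ne_zero (by norm_num) (pow_ne_zero 3 hdQ)
  haveI := isElliptic_mordellCurve h16
  haveI := (threeTorsionModel (6 : ℚ) (-4)).isElliptic_quadraticTwist hdQ
  haveI := (threeIsogenyCodomain (6 : ℚ) (-4)).isElliptic_quadraticTwist hdQ
  refine ⟨d, hd0, hsq, ?_⟩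
  have h1 : IsIsogenous W ((threeTorsionModel (6 : ℚ) (-4)).quadraticTwist (d : ℚ)) :=
    isIsogenous_of_smul_eq hC
  have h2 : IsIsogenous ((threeTorsionModel (6 : ℚ) (-4)).quadraticTwist (d : ℚ))
      ((threeIsogenyCodomain (6 : ℚ) (-4)).quadraticTwist (d : ℚ)) :=
    isIsogenous_cm27.quadraticTwist hdQ
  have h3 : IsIsogenous ((threeIsogenyCodomain (6 : ℚ) (-4)).quadraticTwist (d : ℚ))
      (mordellCurve (16 * (d : ℚ) ^ 3)) := by
    rw [threeIsogenyCodomain_cm27_eq, quadraticTwist_cm27']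
    exact isIsogenous_of_smul_eq (smul_twist_cm27'_eq_mordellCurve (d : ℚ))
  exact h1.trans' (h2.trans' h3)

/-- Conversely `y² = x³ + 16d³` (`d ≠ 0`) is the partner of a GLOBALLY MINIMAL `j = −12288000` curve.
[cite: SilvermanAEC2009, VIII.8, Cor. 8.3] [cite: CremonaAlgorithms1997, §3.8 and Table 1 (classes 27a, 36a)] -/
theorem exists_jNeg12288000_isIsogenous_mordell {d : ℚ} (hd : d ≠ 0) :
    ∃ (W : WeierstrassCurve ℚ) (_ : W.IsElliptic) (_ : W.IsGloballyMinimal),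
      W.j = -12288000 ∧ IsIsogenous W (mordellCurve (16 * d ^ 3)) := by
  haveI hE' := isElliptic_threeIsogenyCodomain (m := (6 : ℚ)) (s := -4)
  have h16 : (16 : ℚ) * d ^ 3 ≠ 0 := mul_ne_zero (by norm_num) (pow_ne_zero 3 hd)
  haveI := isElliptic_mordellCurve h16
  haveI := (threeTorsionModel (6 : ℚ) (-4)).isElliptic_quadraticTwist hd
  haveI := (threeIsogenyCodomain (6 : ℚ) (-4)).isElliptic_quadraticTwist hd
  obtain ⟨C, hC⟩ := hasGlobalMinimalModel_rat_holds
    ((threeTorsionModel (6 : ℚ) (-4)).quadraticTwist d)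
  refine ⟨C • (threeTorsionModel (6 : ℚ) (-4)).quadraticTwist d, inferInstance, hC, ?_, ?_⟩
  · rw [variableChange_j, j_quadraticTwist _ hd, j_threeTorsionModel_cm27]
  · have h2 : IsIsogenous ((threeTorsionModel (6 : ℚ) (-4)).quadraticTwist d)
        ((threeIsogenyCodomain (6 : ℚ) (-4)).quadraticTwist d) :=
      isIsogenous_cm27.quadraticTwist hd
    have h3 : IsIsogenous ((threeIsogenyCodomain (6 : ℚ) (-4)).quadraticTwist d)
        (mordellCurve (16 * d ^ 3)) := by
      rw [threeIsogenyCodomain_cm27_eq, quadraticTwist_cm27']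
      exact isIsogenous_of_smul_eq (smul_twist_cm27'_eq_mordellCurve d)
    exact (isIsogenous_of_smul _ C).trans' (h2.trans' h3)

/-! ## §3 BSD(·,2) along the partner isogeny; the two classes in twist currency -/

/-- **`BSD(W,2) ⟺ BSD(W′,2)`** for globally minimal `W ∼_ℚ W′` in analytic rank `≤ 1`, granted
Cassels (`hCAS`), GZK (`hGZK`) and modularity (`hMOD`) — both directions of Miller's isogeny
invariance (`Wuthrich2014.bsdp_of_isIsogenous`; `r_an` is an isogeny invariant, Faltings).
[cite: MilneADT2006, Thm. I.7.3] [cite: Miller2011LMS, §1 and Def. 1.1] -/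
theorem bsdp_two_iff_of_isIsogenous (hCAS : bsdRHS_eq_of_isIsogenous)
    (hGZK : rank_eq_analyticRank_of_analyticRank_le_one) (hMOD : hasEntireLFunction_rat)
    {W W' : WeierstrassCurve ℚ} [W.IsElliptic] [W.IsGloballyMinimal] [W'.IsElliptic]
    [W'.IsGloballyMinimal] (h : IsIsogenous W W') (hr : W.analyticRank ≤ 1) :
    BSDp W 2 ↔ BSDp W' 2 := by
  have hr' : W'.analyticRank ≤ 1 := by rwa [← analyticRank_eq_of_isIsogenous' h]
  exact ⟨fun hW ↦ Wuthrich2014.bsdp_of_isIsogenous hCAS h.symm_of_charZero (hGZK W hr).2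
      (W.leadingLCoeff_ne_zero_holds (hMOD W)) hW,
    fun hW' ↦ Wuthrich2014.bsdp_of_isIsogenous hCAS h (hGZK W' hr').2
      (W'.leadingLCoeff_ne_zero_holds (hMOD W')) hW'⟩

/-- **The `j = 54000` class of analytic rank one ⟺ the twist family of `36a1`**, granted
Cassels/GZK/modularity: «`BSD(W,2)` for every globally minimal `W` with `r_an = 1`, `j(W) = 54000`»
⟺ «`BSD(W′,2)` for every globally minimal model `W′` (`C • W′ = y² = x³ + d³`), `d ∈ ℚˣ`, of
analytic rank one». [cite: MilneADT2006, Thm. I.7.3] [cite: SilvermanAEC2009, X.5 Cor. 5.4.1]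
[cite: CremonaAlgorithms1997, §3.8 and Table 1 (classes 27a, 36a)] -/
theorem inert_j54000_iff_twist36 (hCAS : bsdRHS_eq_of_isIsogenous)
    (hGZK : rank_eq_analyticRank_of_analyticRank_le_one) (hMOD : hasEntireLFunction_rat) :
    (∀ (W : WeierstrassCurve ℚ) [W.IsElliptic] [W.IsGloballyMinimal],
        W.analyticRank = 1 → W.j = 54000 → BSDp W 2) ↔
      ∀ (d : ℚ), d ≠ 0 → ∀ (W' : WeierstrassCurve ℚ) [W'.IsElliptic] [W'.IsGloballyMinimal]
        (C : VariableChange ℚ), C • W' = mordellCurve (d ^ 3) → W'.analyticRank = 1 → BSDp W' 2 := by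
  constructor
  · intro h d hd W' _ _ C hC hr'
    obtain ⟨W, _, _, hjW, hiso⟩ := exists_j54000_isIsogenous_mordell hd
    have hWW' : IsIsogenous W W' := hiso.trans' (isIsogenous_of_smul_eq' hC)
    have hrW : W.analyticRank = 1 := by rw [analyticRank_eq_of_isIsogenous' hWW']; exact hr'
    exact (bsdp_two_iff_of_isIsogenous hCAS hGZK hMOD hWW' hrW.le).1 (h W hrW hjW)
  · intro h W _ _ hr hj
    obtain ⟨d, hd0, -, hiso⟩ := exists_isIsogenous_mordell_of_j_eq_54000 W hj
    have hdQ : (d : ℚ) ≠ 0 := by exact_mod_cast hd0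
    haveI := isElliptic_mordellCurve (pow_ne_zero 3 hdQ)
    obtain ⟨C, hC⟩ := hasGlobalMinimalModel_rat_holds (mordellCurve ((d : ℚ) ^ 3))
    haveI := hC
    have hWW' : IsIsogenous W (C • mordellCurve ((d : ℚ) ^ 3)) :=
      hiso.trans' (isIsogenous_smul _ C)
    have hr' : (C • mordellCurve ((d : ℚ) ^ 3)).analyticRank = 1 := by
      rw [← analyticRank_eq_of_isIsogenous' hWW']; exact hr
    exact (bsdp_two_iff_of_isIsogenous hCAS hGZK hMOD hWW' hr.le).2
      (h (d : ℚ) hdQ _ C⁻¹ (inv_smul_smul C _) hr')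

/-- **The `j = −12288000` class of analytic rank one ⟺ the twist family of `27a3`**, granted
Cassels/GZK/modularity: «`BSD(W,2)` for every globally minimal `W` with `r_an = 1`,
`j(W) = −12288000`» ⟺ «`BSD(W′,2)` for every globally minimal model `W′`
(`C • W′ = y² = x³ + 16d³`), `d ∈ ℚˣ`, of analytic rank one». [cite: MilneADT2006, Thm. I.7.3]
[cite: SilvermanAEC2009, X.5 Cor. 5.4.1] [cite: CremonaAlgorithms1997, §3.8 and Table 1 (classes 27a, 36a)] -/
theorem inert_jNeg12288000_iff_twist27 (hCAS : bsdRHS_eq_of_isIsogenous)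
    (hGZK : rank_eq_analyticRank_of_analyticRank_le_one) (hMOD : hasEntireLFunction_rat) :
    (∀ (W : WeierstrassCurve ℚ) [W.IsElliptic] [W.IsGloballyMinimal],
        W.analyticRank = 1 → W.j = -12288000 → BSDp W 2) ↔
      ∀ (d : ℚ), d ≠ 0 → ∀ (W' : WeierstrassCurve ℚ) [W'.IsElliptic] [W'.IsGloballyMinimal]
        (C : VariableChange ℚ), C • W' = mordellCurve (16 * d ^ 3) → W'.analyticRank = 1 →
          BSDp W' 2 := by
  constructor
  · intro h d hd W' _ _ C hC hr'
    obtain ⟨W, _, _, hjW, hiso⟩ := exists_jNeg12288000_isIsogenous_mordell hd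
    have hWW' : IsIsogenous W W' := hiso.trans' (isIsogenous_of_smul_eq' hC)
    have hrW : W.analyticRank = 1 := by rw [analyticRank_eq_of_isIsogenous' hWW']; exact hr'
    exact (bsdp_two_iff_of_isIsogenous hCAS hGZK hMOD hWW' hrW.le).1 (h W hrW hjW)
  · intro h W _ _ hr hj
    obtain ⟨d, hd0, -, hiso⟩ := exists_isIsogenous_mordell_of_j_eq_neg12288000 W hj
    have hdQ : (d : ℚ) ≠ 0 := by exact_mod_cast hd0
    have h16 : (16 : ℚ) * (d : ℚ) ^ 3 ≠ 0 := mul_ne_zero (by norm_num) (pow_ne_zero 3 hdQ)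
    haveI := isElliptic_mordellCurve h16
    obtain ⟨C, hC⟩ := hasGlobalMinimalModel_rat_holds (mordellCurve (16 * (d : ℚ) ^ 3))
    haveI := hC
    have hWW' : IsIsogenous W (C • mordellCurve (16 * (d : ℚ) ^ 3)) :=
      hiso.trans' (isIsogenous_smul _ C)
    have hr' : (C • mordellCurve (16 * (d : ℚ) ^ 3)).analyticRank = 1 := by
      rw [← analyticRank_eq_of_isIsogenous' hWW']; exact hr
    exact (bsdp_two_iff_of_isIsogenous hCAS hGZK hMOD hWW' hr.le).2
      (h (d : ℚ) hdQ _ C⁻¹ (inv_smul_smul C _) hr')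

end Summit.BirchSwinnertonDyer.BirchSwinnertonDyer.Theorems.PrintCf2

end
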